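import Literature.Analysis.FunctionSpaces.RadialCapacitorFour
import Literature.Analysis.FunctionSpaces.SymmetricDecreasingRearrangement
import Mathlib.MeasureTheory.Function.L2Space
import Mathlib.Topology.UniformSpace.HeineCantor
import HarnessLib

/-!
# A discretised Pólya–Szegő inequality in dimension four

Topic `Literature/Analysis/FunctionSpaces`. The Pólya–Szegő principle says that the Dirichlet
energy does not increase under symmetric decreasing rearrangement, `∫ |∇u♯|² ≤ ∫ |∇u|²`; on a space
whose isoperimetric profile is `I(v) = c v^{3/4}` (a `CD(0,4)` space with `AVR = θ`,
`c = 4 ω₄^{1/4} θ^{1/4}`: Balogh–Kristály 2023; Nobili–Violo 2022/2024) the Euclidean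
rearrangement onto `ℝ⁴` satisfies `∫_{ℝ⁴} |∇u♯|² dx ≤ (4ω₄^{1/4}/c)² ∫ |∇u|²` (Nobili–Violo 2024,
Prop. 3.3; Balogh–Kristály–Tripaldi 2024, (2.4)). Its classical proof (Talenti 1976) combines the
coarea formula, the isoperimetric inequality of the superlevel sets and a one-dimensional
Cauchy–Schwarz argument, and needs the absolute continuity of the rearranged profile.

This file proves a DISCRETISED form that suffices for limiting arguments (e.g. the sharp
log-Sobolev inequality `Literature.Geometry.Riemannian.sharpLogSobolevAVR_four`) and needs neither
Sobolev regularity of `u♯` nor the coarea formula: from the **slab inequality**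

  `∫_{t₁}^{t₂} c · μ{w > t}^{3/4} dt ≤ ∫_{t₁ < w < t₂} ρ dμ`     (`0 ≤ t₁ < t₂`)

for a bounded non-negative `w` (think `w = |u|`) and a square-integrable `ρ ≥ 0` (think `|∇u|`)
on an arbitrary measure space — which is what isoperimetry plus coarea (or
`Literature.Geometry.Riemannian.lintegral_isoperimetricProfile_le_lintegral_slab`) provide — or
merely from the weaker **level bound** `c · μ{w ≥ t₂}^{3/4} · (t₂ − t₁) ≤ ∫_{t₁ < w < t₂} ρ dμ`
(what the sharp `L¹`-Sobolev inequality `c ‖φ‖_{4/3} ≤ ∫ |∇φ|` gives on truncations of `w`;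
`exists_lipschitz_discretePolyaSzego_four_of_levelBound`), we
construct, for every `ε > 0`, a compactly supported LIPSCHITZ radial `v : ℝ⁴ → ℝ` with
`|∫ v² − ∫ w²| ≤ ε`, `∫ w² log w² ≤ ∫ v² log v² + ε` and
`∫ ‖Dv‖² ≤ (8√2 π / c²) ∫ ρ² dμ + ε` (`exists_lipschitz_discretePolyaSzego_four`); for
`c = 4ω₄^{1/4}θ^{1/4}` the constant `8√2π/c²` is `θ^{-1/2}`, the Pólya–Szegő constant of (2.4).

The function `v` is the staircase `∑_j (τ_{j+1} − τ_j) · annulusCap R_{j+1} R_j`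
(`RadialCapacitorFour.lean`) through the values `τ_j = u♯(R_j e)` of the rearrangement
`u♯ = symmDecRearr 4 μ w` on a fine uniform mesh of radii: on each annulus it is the capacitor
potential, whose energy `4π²(Δτ)²/(R_{j+1}⁻² − R_j⁻²)` is controlled, through the slab inequality on
the slab `τ_j < w < τ_{j+1}`, Cauchy–Schwarz and the equimeasurability of `u♯`, by
`(4√2π/c²) · q²(q²+1) · ∫_{τ_j<w<τ_{j+1}} ρ²`, `q = R_j/R_{j+1}` (`slab_energy_bound`); summing over
the disjoint slabs and letting the mesh ratio `q → 1` gives the energy bound, while `|v − u♯|` is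
small off a small ball because `u♯` is continuous (`continuous_symmDecRearr`, the distribution
function of `w` having no plateau) — so `∫ v²`, `∫ v² log v²` are close to those of `u♯`, which are
those of `w` (equimeasurability).

Everything is proved; no definitions, no named facts.

## References

* G. Talenti, *Best constant in Sobolev inequality*, Ann. Mat. Pura Appl. 110 (1976), (29)–(32).
* [NobiliViolo2024] F. Nobili, I. Y. Violo, Adv. Math. 440 (2024) 109521, §3.1, Prop. 3.3.
* [BaloghKristalyTripaldi2024] Z. M. Balogh, A. Kristály, F. Tripaldi, J. Funct. Anal. 286 (2024)
  110217, §2.1 (2.3)–(2.4), §3.1.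
* G. Pólya, G. Szegő, *Isoperimetric Inequalities in Mathematical Physics*, Princeton 1951.
-/

noncomputable section

open MeasureTheory Set Filter Topology Metric Real
open scoped ENNReal NNReal

namespace Literature.Analysis.FunctionSpaces

/-! ### Elementary inequalities -/

/-- `((ω a⁴)^{3/4})² = ω √ω a⁶` for `ω, a ≥ 0`. [folklore] -/
theorem rpow_three_quarters_sq {ω a : ℝ} (hω : 0 ≤ ω) :
    ((ω * a ^ 4) ^ (3 / 4 : ℝ)) ^ 2 = ω * Real.sqrt ω * a ^ 6 := by
  have h0 : 0 ≤ ω * a ^ 4 := by positivity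
  rw [← Real.rpow_natCast, ← Real.rpow_mul h0]
  norm_num
  rw [show (3 / 2 : ℝ) = 1 + 1 / 2 by norm_num, Real.rpow_add' h0 (by norm_num), Real.rpow_one,
    ← Real.sqrt_eq_rpow, Real.sqrt_mul' _ (by positivity : (0 : ℝ) ≤ a ^ 4),
    show a ^ 4 = (a ^ 2) ^ 2 by ring, Real.sqrt_sq (by positivity)]
  ring

/-- The mesh-ratio factor: `q²(q² + 1) ≤ 2 + 10 s` for `1 ≤ q ≤ 1 + s`, `0 ≤ s ≤ 1/4`. [folklore] -/
theorem ratio_factor_le {q s : ℝ} (h1 : 1 ≤ q) (h2 : q ≤ 1 + s) (hs : 0 ≤ s) (hs' : s ≤ 1 / 4) :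
    q ^ 2 * (q ^ 2 + 1) ≤ 2 + 10 * s := by
  have hq : 0 ≤ q := zero_le_one.trans h1
  have hq2 : q ^ 2 ≤ (1 + s) ^ 2 := pow_le_pow_left₀ hq h2 2
  have hq4 : q ^ 2 * (q ^ 2 + 1) ≤ (1 + s) ^ 2 * ((1 + s) ^ 2 + 1) := by
    apply mul_le_mul hq2 (by linarith) (by positivity) (by positivity)
  have e : (1 + s) ^ 2 * ((1 + s) ^ 2 + 1) = 2 + 6 * s + 7 * s ^ 2 + 4 * s ^ 3 + s ^ 4 := by ring
  have h3 : s ^ 2 ≤ s / 4 := by nlinarith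
  have h4 : s ^ 3 ≤ s / 16 := by nlinarith
  have h5 : s ^ 4 ≤ s / 64 := by nlinarith
  linarith

/-- **The algebra of one slab.** With `D = a⁻² − b⁻²`, if `c (ω a⁴)^{3/4} d ≤ L`, `L² ≤ A E` and
`A ≤ ω(b⁴ − a⁴)` (the slab inequality with the lower volume bound, Cauchy–Schwarz, and the
volume of the slab), then the capacitor energy `4π² d²/D` is at most
`(4π²/(c² √ω)) · (b²(b² + a²)/a⁴) · E`. [folklore] -/
theorem slab_energy_algebra {c ω a b d L A E : ℝ} (hc : 0 < c) (hω : 0 < ω) (ha : 0 < a)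
    (hab : a < b) (hd : 0 ≤ d) (h1 : c * (ω * a ^ 4) ^ (3 / 4 : ℝ) * d ≤ L) (h2 : L ^ 2 ≤ A * E)
    (hE : 0 ≤ E) (h3 : A ≤ ω * (b ^ 4 - a ^ 4)) :
    4 * Real.pi ^ 2 * d ^ 2 / annulusCapD a b ≤
      (4 * Real.pi ^ 2 / (c ^ 2 * Real.sqrt ω)) * (b ^ 2 * (b ^ 2 + a ^ 2) / a ^ 4) * E := by
  have hD := annulusCapD_pos ha hab
  have hsω : 0 < Real.sqrt ω := Real.sqrt_pos.2 hω
  have hb : 0 < b := ha.trans hab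
  -- square the slab inequality
  have hP : 0 ≤ c * (ω * a ^ 4) ^ (3 / 4 : ℝ) * d := by positivity
  have h1sq : (c * (ω * a ^ 4) ^ (3 / 4 : ℝ) * d) ^ 2 ≤ L ^ 2 := pow_le_pow_left₀ hP h1 2
  rw [mul_pow, mul_pow, rpow_three_quarters_sq (a := a) hω.le] at h1sq
  -- `c² ω √ω a⁶ d² ≤ A E ≤ ω (b⁴ − a⁴) E`
  have h4 : c ^ 2 * (ω * Real.sqrt ω * a ^ 6) * d ^ 2 ≤ ω * (b ^ 4 - a ^ 4) * E :=
    (h1sq.trans h2).trans (mul_le_mul_of_nonneg_right h3 hE)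
  -- rewrite the goal
  have hDeq : annulusCapD a b = (b ^ 2 - a ^ 2) / (a ^ 2 * b ^ 2) := by
    unfold annulusCapD
    field_simp
  rw [hDeq, div_div_eq_mul_div]
  rw [div_le_iff₀ (by nlinarith [mul_pos ha hb])]
  -- target: 4π² d² (a²b²) ≤ (4π²/(c²√ω)) (b²(b²+a²)/a⁴) E (b² − a²)
  have key : d ^ 2 * (a ^ 2 * b ^ 2) ≤
      1 / (c ^ 2 * Real.sqrt ω) * (b ^ 2 * (b ^ 2 + a ^ 2) / a ^ 4) * E * (b ^ 2 - a ^ 2) := by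
    have hba : 0 < b ^ 2 - a ^ 2 := by nlinarith [mul_pos ha hb]
    -- from `h4`: `d² ≤ (b⁴ − a⁴) E / (c² √ω a⁶)`
    have h5 : d ^ 2 ≤ (b ^ 4 - a ^ 4) * E / (c ^ 2 * Real.sqrt ω * a ^ 6) := by
      rw [le_div_iff₀ (by positivity)]
      calc d ^ 2 * (c ^ 2 * Real.sqrt ω * a ^ 6) = c ^ 2 * (ω * Real.sqrt ω * a ^ 6) * d ^ 2 / ω := by
            field_simp
        _ ≤ ω * (b ^ 4 - a ^ 4) * E / ω := by gcongr
        _ = (b ^ 4 - a ^ 4) * E := by field_simp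
    calc d ^ 2 * (a ^ 2 * b ^ 2) ≤ (b ^ 4 - a ^ 4) * E / (c ^ 2 * Real.sqrt ω * a ^ 6) * (a ^ 2 * b ^ 2) :=
          mul_le_mul_of_nonneg_right h5 (by positivity)
      _ = 1 / (c ^ 2 * Real.sqrt ω) * (b ^ 2 * (b ^ 2 + a ^ 2) / a ^ 4) * E * (b ^ 2 - a ^ 2) := by
          field_simp
          ring
  calc 4 * Real.pi ^ 2 * d ^ 2 * (a ^ 2 * b ^ 2) = 4 * Real.pi ^ 2 * (d ^ 2 * (a ^ 2 * b ^ 2)) := by ring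
    _ ≤ 4 * Real.pi ^ 2 * (1 / (c ^ 2 * Real.sqrt ω) * (b ^ 2 * (b ^ 2 + a ^ 2) / a ^ 4) * E *
        (b ^ 2 - a ^ 2)) := by gcongr
    _ = 4 * Real.pi ^ 2 / (c ^ 2 * Real.sqrt ω) * (b ^ 2 * (b ^ 2 + a ^ 2) / a ^ 4) * E *
        (b ^ 2 - a ^ 2) := by ring

/-- `4π²/(c² √(π²/2)) = 4√2 π/c²` and hence `(4π²/(c²√(π²/2))) · 2 = 8√2π/c²`. [folklore] -/
theorem energy_constant_eq {c : ℝ} (hc : c ≠ 0) :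
    4 * Real.pi ^ 2 / (c ^ 2 * Real.sqrt (Real.pi ^ 2 / 2)) = 4 * Real.sqrt 2 * Real.pi / c ^ 2 := by
  have hπ := Real.pi_pos
  have hs2 : 0 < Real.sqrt 2 := Real.sqrt_pos.2 two_pos
  have h2 : Real.sqrt 2 ^ 2 = 2 := Real.sq_sqrt zero_le_two
  rw [Real.sqrt_div' _ zero_le_two, Real.sqrt_sq hπ.le,
    div_eq_div_iff (by positivity) (by positivity)]
  field_simp

/-! ### Cauchy–Schwarz on a slab -/

/-- `(∫_S ρ)² ≤ μ(S) ∫_S ρ²` for `ρ ≥ 0` (Cauchy–Schwarz). [folklore] -/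
theorem sq_setIntegral_le_measure_mul {X : Type*} [MeasurableSpace X] {μ : Measure X} {ρ : X → ℝ}
    {S : Set X} (hμS : μ S ≠ ∞) (hρ0 : ∀ a, 0 ≤ ρ a) (hρm : AEStronglyMeasurable ρ μ)
    (hρ2 : IntegrableOn (fun a ↦ ρ a ^ 2) S μ) :
    (∫ a in S, ρ a ∂μ) ^ 2 ≤ (μ S).toReal * ∫ a in S, ρ a ^ 2 ∂μ := by
  haveI : IsFiniteMeasure (μ.restrict S) := isFiniteMeasure_restrict.2 hμS
  have hg : MemLp ρ (ENNReal.ofReal 2) (μ.restrict S) := by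
    rw [ENNReal.ofReal_ofNat]
    exact (memLp_two_iff_integrable_sq hρm.restrict).2 hρ2
  have h := integral_mul_le_Lp_mul_Lq_of_nonneg (μ := μ.restrict S) Real.HolderConjugate.two_two
    (f := fun _ ↦ (1 : ℝ)) (g := ρ) (ae_of_all _ fun _ ↦ zero_le_one) (ae_of_all _ hρ0)
    (memLp_const 1) hg
  simp only [one_mul, Real.rpow_two, one_pow, integral_const, smul_eq_mul, mul_one] at h
  have hA : 0 ≤ (μ.restrict S).real univ := measureReal_nonneg
  have hE : 0 ≤ ∫ a in S, ρ a ^ 2 ∂μ := integral_nonneg fun a ↦ sq_nonneg _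
  have hL : 0 ≤ ∫ a in S, ρ a ∂μ := integral_nonneg hρ0
  have hA' : (μ.restrict S).real univ = (μ S).toReal := by
    rw [measureReal_def, Measure.restrict_apply_univ]
  rw [hA'] at h hA
  calc (∫ a in S, ρ a ∂μ) ^ 2 ≤ ((μ S).toReal ^ (1 / 2 : ℝ) * (∫ a in S, ρ a ^ 2 ∂μ) ^ (1 / 2 : ℝ)) ^ 2 :=
        pow_le_pow_left₀ hL h 2
    _ = (μ S).toReal * ∫ a in S, ρ a ^ 2 ∂μ := by
        rw [mul_pow, ← Real.sqrt_eq_rpow, ← Real.sqrt_eq_rpow, Real.sq_sqrt hA, Real.sq_sqrt hE]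

/-! ### Closeness of integrals of bounded radial-shell approximations -/

/-- **Integrals of `Φ ∘ f` and `Φ ∘ g` are close** when `f, g : ℝ⁴ → [0, M]` vanish outside
`B̄(0, r₀)`, differ by at most `δ` outside `B(0, r₁)`, `Φ(0) = 0`, `|Φ| ≤ B` on `[0, M]`, and `Φ`
varies by at most `η` on `δ`-close points of `[0, M]`:
`|∫ Φ∘f − ∫ Φ∘g| ≤ 2B |B(0,r₁)| + η |B̄(0,r₀)|`. [folklore] -/
theorem abs_integral_comp_sub_le {f g : EuclideanSpace ℝ (Fin 4) → ℝ} {Φ : ℝ → ℝ}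
    {M B δ η r₁ r₀ : ℝ} (hfm : Measurable f) (hgm : Measurable g) (hΦ : Continuous Φ)
    (hΦ0 : Φ 0 = 0) (hf : ∀ x, f x ∈ Icc 0 M) (hg : ∀ x, g x ∈ Icc 0 M)
    (hB : ∀ s ∈ Icc 0 M, |Φ s| ≤ B)
    (hΦδ : ∀ s ∈ Icc 0 M, ∀ s' ∈ Icc 0 M, |s - s'| ≤ δ → |Φ s - Φ s'| ≤ η) (hη : 0 ≤ η)
    (hclose : ∀ x, r₁ ≤ ‖x‖ → |f x - g x| ≤ δ)
    (hf0 : ∀ x, r₀ < ‖x‖ → f x = 0) (hg0 : ∀ x, r₀ < ‖x‖ → g x = 0) :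
    |(∫ x, Φ (f x)) - ∫ x, Φ (g x)| ≤
      2 * B * (volume (ball (0 : EuclideanSpace ℝ (Fin 4)) r₁)).toReal +
        η * (volume (closedBall (0 : EuclideanSpace ℝ (Fin 4)) r₀)).toReal := by
  have hB0 : 0 ≤ B := (abs_nonneg _).trans (hB 0 ⟨le_rfl, (hf 0).1.trans (hf 0).2⟩)
  -- the dominating function
  set h : EuclideanSpace ℝ (Fin 4) → ℝ := fun x ↦
    (ball (0 : EuclideanSpace ℝ (Fin 4)) r₁).indicator (fun _ ↦ 2 * B) x +
      (closedBall (0 : EuclideanSpace ℝ (Fin 4)) r₀).indicator (fun _ ↦ η) x with hh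
  have hbound : ∀ x, |Φ (f x) - Φ (g x)| ≤ h x := by
    intro x
    by_cases hx1 : ‖x‖ < r₁
    · have : |Φ (f x) - Φ (g x)| ≤ 2 * B := by
        calc |Φ (f x) - Φ (g x)| ≤ |Φ (f x)| + |Φ (g x)| := abs_sub _ _
          _ ≤ B + B := add_le_add (hB _ (hf x)) (hB _ (hg x))
          _ = 2 * B := by ring
      refine this.trans ?_
      simp only [hh]
      rw [indicator_of_mem (by simpa using hx1)]
      have : 0 ≤ (closedBall (0 : EuclideanSpace ℝ (Fin 4)) r₀).indicator (fun _ ↦ η) x := by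
        by_cases hx : x ∈ closedBall (0 : EuclideanSpace ℝ (Fin 4)) r₀
        · rw [indicator_of_mem hx]; exact hη
        · rw [indicator_of_notMem hx]
      linarith
    · rw [not_lt] at hx1
      by_cases hx0 : ‖x‖ ≤ r₀
      · have : |Φ (f x) - Φ (g x)| ≤ η := hΦδ _ (hf x) _ (hg x) (hclose x hx1)
        refine this.trans ?_
        simp only [hh]
        rw [indicator_of_mem (by simpa using hx0 : x ∈ closedBall (0 : EuclideanSpace ℝ (Fin 4)) r₀)]
        have : 0 ≤ (ball (0 : EuclideanSpace ℝ (Fin 4)) r₁).indicator (fun _ ↦ 2 * B) x := by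
          by_cases hx : x ∈ ball (0 : EuclideanSpace ℝ (Fin 4)) r₁
          · rw [indicator_of_mem hx]; positivity
          · rw [indicator_of_notMem hx]
        linarith
      · rw [not_le] at hx0
        rw [hf0 x hx0, hg0 x hx0, sub_self, abs_zero]
        simp only [hh]
        refine add_nonneg ?_ ?_
        · by_cases hx : x ∈ ball (0 : EuclideanSpace ℝ (Fin 4)) r₁
          · rw [indicator_of_mem hx]; positivity
          · rw [indicator_of_notMem hx]
        · by_cases hx : x ∈ closedBall (0 : EuclideanSpace ℝ (Fin 4)) r₀
          · rw [indicator_of_mem hx]; exact hη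
          · rw [indicator_of_notMem hx]
  -- integrability of `Φ ∘ f`, `Φ ∘ g` (bounded, measurable, supported in `B̄(0, r₀)`)
  have hK : IsCompact (closedBall (0 : EuclideanSpace ℝ (Fin 4)) r₀) := isCompact_closedBall _ _
  have hint : ∀ {k : EuclideanSpace ℝ (Fin 4) → ℝ}, Measurable k → (∀ x, k x ∈ Icc 0 M) →
      (∀ x, r₀ < ‖x‖ → k x = 0) → Integrable (fun x ↦ Φ (k x)) volume := by
    intro k hkm hk hk0
    refine Integrable.mono' ((integrable_indicator_iff hK.measurableSet).2
      (integrableOn_const (C := B) (hs := hK.measure_lt_top.ne)))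
      (hΦ.measurable.comp hkm).aestronglyMeasurable (ae_of_all _ fun x ↦ ?_)
    by_cases hx : x ∈ closedBall (0 : EuclideanSpace ℝ (Fin 4)) r₀
    · rw [indicator_of_mem hx, Real.norm_eq_abs]
      exact hB _ (hk x)
    · rw [indicator_of_notMem hx, Real.norm_eq_abs]
      have : r₀ < ‖x‖ := by simpa using hx
      rw [hk0 x this, hΦ0, abs_zero]
  have hif := hint hfm hf hf0
  have hig := hint hgm hg hg0
  have hhi : Integrable h volume :=
    ((integrable_indicator_iff measurableSet_ball).2
      (integrableOn_const measure_ball_lt_top.ne)).add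
      ((integrable_indicator_iff hK.measurableSet).2 (integrableOn_const hK.measure_lt_top.ne))
  rw [← integral_sub hif hig]
  calc |∫ x, Φ (f x) - Φ (g x)| ≤ ∫ x, |Φ (f x) - Φ (g x)| := abs_integral_le_integral_abs
    _ ≤ ∫ x, h x := integral_mono (hif.sub hig).abs hhi hbound
    _ = 2 * B * (volume (ball (0 : EuclideanSpace ℝ (Fin 4)) r₁)).toReal +
        η * (volume (closedBall (0 : EuclideanSpace ℝ (Fin 4)) r₀)).toReal := by
        simp only [hh]
        rw [integral_add ((integrable_indicator_iff measurableSet_ball).2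
            (integrableOn_const measure_ball_lt_top.ne))
            ((integrable_indicator_iff hK.measurableSet).2 (integrableOn_const hK.measure_lt_top.ne)),
          integral_indicator_const _ measurableSet_ball, integral_indicator_const _ hK.measurableSet,
          smul_eq_mul, smul_eq_mul, Measure.real, Measure.real]
        ring

/-! ### Covering of the shell by the closed annuli of a mesh -/

/-- For radii `R 0 ≥ r ≥ R N` (`N ≥ 1`) there is an index `i < N` with `R (i+1) ≤ r ≤ R i`.
[folklore] -/
theorem exists_index_of_mem_shell {R : ℕ → ℝ} {N : ℕ} (hN : 0 < N) {r : ℝ} (h1 : R N ≤ r)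
    (h2 : r ≤ R 0) : ∃ i < N, R (i + 1) ≤ r ∧ r ≤ R i := by
  classical
  have hex : ∃ i, R (i + 1) ≤ r := ⟨N - 1, by rwa [Nat.sub_add_cancel hN]⟩
  refine ⟨Nat.find hex, ?_, Nat.find_spec hex, ?_⟩
  · have : Nat.find hex ≤ N - 1 := Nat.find_min' hex (by rwa [Nat.sub_add_cancel hN])
    omega
  · rcases Nat.eq_zero_or_pos (Nat.find hex) with h0 | hpos
    · rw [h0]; exact h2
    · have := Nat.find_min hex (m := Nat.find hex - 1) (by omega)
      rw [Nat.sub_add_cancel hpos, not_le] at this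
      exact this.le

/-! ### The discretised Pólya–Szegő inequality -/

set_option maxHeartbeats 1600000 in -- a long but elementary ε-bookkeeping proof
/-- **Discretised Pólya–Szegő inequality in dimension four, from the level bound.** Let `w ≥ 0`
be a bounded measurable function on a measure space with `0 < μ{w > 0} < ∞`, whose distribution
function `t ↦ μ{w > t}` is strictly decreasing on `[0, M]` (`w ≤ M`), and let `ρ ≥ 0` be measurable
and square-integrable. Suppose the **level bound**
`c · μ{w ≥ t₂}^{3/4} · (t₂ − t₁) ≤ ∫_{t₁ < w < t₂} ρ dμ` holds for all `0 ≤ t₁ < t₂` — which is what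
either the isoperimetric inequality of the superlevel sets with profile `c v^{3/4}` (integrated in
the level, `exists_lipschitz_discretePolyaSzego_four`) or the `L¹`-Sobolev inequality
`c ‖φ‖_{4/3} ≤ ∫ |∇φ|` applied to truncations of `w` between the two levels provides. Then for
every `ε > 0` there is a compactly supported Lipschitz `v : ℝ⁴ → ℝ` with `|∫ v² dx − ∫ w² dμ| ≤ ε`,
`∫ w² log w² dμ ≤ ∫ v² log v² dx + ε` and `∫ ‖Dv‖² dx ≤ (8√2π/c²) ∫ ρ² dμ + ε` — a staircase of
capacitor potentials through the values of `u♯ = symmDecRearr 4 μ w` on a fine mesh of radii (see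
the module docstring). For `c = 4 ω₄^{1/4} θ^{1/4}` the constant is `θ^{-1/2}`, that of the
Pólya–Szegő inequality (2.4) of Balogh–Kristály–Tripaldi 2024 / Nobili–Violo 2024, Prop. 3.3.
[cite: BaloghKristalyTripaldi2024, §2.1 (2.4) and §3.1] [cite: NobiliViolo2024, §3.1 Prop. 3.3] -/
theorem exists_lipschitz_discretePolyaSzego_four_of_levelBound
    {X : Type*} [MeasurableSpace X] {μ : Measure X} {w ρ : X → ℝ}
    (hw : Measurable w) (hw0 : ∀ a, 0 ≤ w a) {M : ℝ} (hM0 : 0 < M) (hwM : ∀ a, w a ≤ M)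
    (hfin : μ {a | 0 < w a} ≠ ∞) (hpos : μ {a | 0 < w a} ≠ 0)
    (hstrict : StrictAntiOn (fun t ↦ μ {a | t < w a}) (Icc 0 M))
    (hρm : Measurable ρ) (hρ0 : ∀ a, 0 ≤ ρ a)
    (hρ2 : Integrable (fun a ↦ ρ a ^ 2) μ) {c : ℝ} (hc : 0 < c)
    (hlevel : ∀ t₁ t₂ : ℝ, 0 ≤ t₁ → t₁ < t₂ →
      c * (μ {a | t₂ ≤ w a}).toReal ^ (3 / 4 : ℝ) * (t₂ - t₁) ≤
        ∫ a in {a | t₁ < w a ∧ w a < t₂}, ρ a ∂μ)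
    {ε : ℝ} (hε : 0 < ε) :
    ∃ (v : EuclideanSpace ℝ (Fin 4) → ℝ) (K : ℝ≥0), LipschitzWith K v ∧ HasCompactSupport v ∧
      |(∫ x, v x ^ 2) - (∫ a, w a ^ 2 ∂μ)| ≤ ε ∧
      (∫ a, w a ^ 2 * Real.log (w a ^ 2) ∂μ) ≤ (∫ x, v x ^ 2 * Real.log (v x ^ 2)) + ε ∧
      (∫ x, ‖fderiv ℝ v x‖ ^ 2) ≤ (8 * Real.sqrt 2 * Real.pi / c ^ 2) * (∫ a, ρ a ^ 2 ∂μ) + ε := by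
  ------------------------------------------------------------------
  -- Step 0: the rearrangement `U = u♯` and its basic properties
  ------------------------------------------------------------------
  have four_ne : (4 : ℕ) ≠ 0 := by norm_num
  have hM' : μ {a | M < w a} = 0 := by
    have : {a | M < w a} = ∅ := eq_empty_of_forall_notMem fun a ha ↦ (not_lt.2 (hwM a)) ha
    rw [this, measure_empty]
  set U : EuclideanSpace ℝ (Fin 4) → ℝ := symmDecRearr 4 μ w with hU
  have hU0 : ∀ x, 0 ≤ U x := fun x ↦ symmDecRearr_nonneg x
  have hUM : ∀ x, U x ≤ M := fun x ↦ symmDecRearr_le hM' hM0.le x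
  have hUm : Measurable U := measurable_symmDecRearr hM'
  have hUc : Continuous U := continuous_symmDecRearr four_ne hM' hM0.le hstrict
  have hUanti : ∀ {x y : EuclideanSpace ℝ (Fin 4)}, ‖x‖ ≤ ‖y‖ → U y ≤ U x := fun h ↦
    symmDecRearr_antitone hM' h
  -- unit ball volume `σ`, `σ = π²/2 =: ω`
  set σ : ℝ≥0∞ := volume (ball (0 : EuclideanSpace ℝ (Fin 4)) 1) with hσ
  set ω : ℝ := Real.pi ^ 2 / 2 with hω
  have hωpos : 0 < ω := by positivity
  have hσT : σ ≠ ⊤ := measure_ball_lt_top.ne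
  have hσω : σ.toReal = ω := volume_real_ball_zero_one_four
  have hvball : ∀ r : ℝ, 0 ≤ r →
      (volume (ball (0 : EuclideanSpace ℝ (Fin 4)) r)).toReal = ω * r ^ 4 := by
    intro r hr
    rw [Measure.addHaar_ball volume 0 hr, finrank_euclideanSpace_fin, ENNReal.toReal_mul,
      ENNReal.toReal_ofReal (by positivity), hσω, mul_comm]
  have hvcball : ∀ r : ℝ, 0 ≤ r →
      (volume (closedBall (0 : EuclideanSpace ℝ (Fin 4)) r)).toReal = ω * r ^ 4 := by
    intro r hr
    rw [Measure.addHaar_closedBall volume 0 hr, finrank_euclideanSpace_fin, ENNReal.toReal_mul,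
      ENNReal.toReal_ofReal (by positivity), hσω, mul_comm]
  have hvballT : ∀ r : ℝ, volume (ball (0 : EuclideanSpace ℝ (Fin 4)) r) ≠ ⊤ := fun r ↦
    measure_ball_lt_top.ne
  have hvcballT : ∀ r : ℝ, volume (closedBall (0 : EuclideanSpace ℝ (Fin 4)) r) ≠ ⊤ := fun r ↦
    (isCompact_closedBall _ _).measure_lt_top.ne
  -- the support radius `ρ₀`
  obtain ⟨ρ₀, hρ₀0, hball0, hvol0⟩ := exists_setOf_volume_ball_lt_eq_ball four_ne hfin
  have hUpos : ∀ x, 0 < U x ↔ x ∈ ball (0 : EuclideanSpace ℝ (Fin 4)) ρ₀ := by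
    intro x
    rw [hU, lt_symmDecRearr_iff hM' le_rfl, ← hball0]
    rfl
  have hUzero : ∀ x : EuclideanSpace ℝ (Fin 4), ρ₀ ≤ ‖x‖ → U x = 0 := by
    intro x hx
    have : ¬ 0 < U x := fun h ↦ by
      have := (hUpos x).1 h
      rw [mem_ball_zero_iff] at this
      linarith
    exact le_antisymm (not_lt.1 this) (hU0 x)
  have hρ₀pos : 0 < ρ₀ := by
    by_contra h
    have h0 : ρ₀ = 0 := le_antisymm (not_lt.1 h) hρ₀0
    rw [h0, ball_zero, measure_empty] at hvol0
    exact hpos hvol0.symm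
  -- finiteness of superlevel sets of non-negative level
  have hfin' : ∀ {t : ℝ}, 0 ≤ t → μ {a | t < w a} ≠ ∞ := fun ht ↦
    ne_top_of_le_ne_top hfin (measure_mono fun a (ha : _ < w a) ↦ lt_of_le_of_lt ht ha)
  -- the ray profile `f r = U (r e)`
  set e : EuclideanSpace ℝ (Fin 4) := EuclideanSpace.single 0 1 with he
  have he1 : ‖e‖ = 1 := by rw [he]; simp
  have hnorm : ∀ r : ℝ, 0 ≤ r → ‖r • e‖ = r := fun r hr ↦ by
    rw [norm_smul, he1, mul_one, Real.norm_of_nonneg hr]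
  set f : ℝ → ℝ := fun r ↦ U (r • e) with hf
  have hfc : Continuous f := hUc.comp (continuous_id.smul continuous_const)
  have hfanti : ∀ {r r' : ℝ}, 0 ≤ r → r ≤ r' → f r' ≤ f r := fun {r r'} hr hrr' ↦ by
    simp only [hf]
    exact hUanti (by rw [hnorm r hr, hnorm r' (hr.trans hrr')]; exact hrr')
  have hf0 : f ρ₀ = 0 := hUzero _ (by rw [hnorm ρ₀ hρ₀0])
  have hfM : ∀ r, f r ≤ M := fun r ↦ hUM _
  have hfnn : ∀ r, 0 ≤ f r := fun r ↦ hU0 _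
  ------------------------------------------------------------------
  -- Step 1: constants and the choice of the parameters
  ------------------------------------------------------------------
  set G : ℝ := ∫ a, ρ a ^ 2 ∂μ with hG
  have hG0 : 0 ≤ G := integral_nonneg fun a ↦ sq_nonneg _
  set Kc : ℝ := 4 * Real.pi ^ 2 / (c ^ 2 * Real.sqrt ω) with hKc
  have hKc0 : 0 < Kc := by positivity
  have hKc2 : 2 * Kc = 8 * Real.sqrt 2 * Real.pi / c ^ 2 := by
    rw [hKc, hω, energy_constant_eq hc.ne']
    ring
  -- mesh ratio slack `s`
  set s : ℝ := min (1 / 4) (ε / (20 * (Kc * G + 1))) with hs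
  have hs0 : 0 < s := by positivity
  have hs4 : s ≤ 1 / 4 := min_le_left _ _
  have hsG : 10 * Kc * s * G ≤ ε / 2 := by
    have h1 : s ≤ ε / (20 * (Kc * G + 1)) := min_le_right _ _
    have h2 : 10 * Kc * s * G ≤ 10 * Kc * G * (ε / (20 * (Kc * G + 1))) := by
      calc 10 * Kc * s * G = (10 * Kc * G) * s := by ring
        _ ≤ (10 * Kc * G) * (ε / (20 * (Kc * G + 1))) := by gcongr
    refine h2.trans ?_
    rw [mul_div_assoc', div_le_iff₀ (by positivity)]
    nlinarith [mul_nonneg hKc0.le hG0]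
  -- bounds of `s²` and `s² log s²` on `[0, M]`
  set Φe : ℝ → ℝ := fun t ↦ t ^ 2 * Real.log (t ^ 2) with hΦe
  have hΦec : Continuous Φe := Real.continuous_mul_log.comp (continuous_pow 2) |>.congr (fun t ↦ rfl)
  obtain ⟨Be, hBe⟩ : ∃ B : ℝ, ∀ t ∈ Icc (0 : ℝ) M, |Φe t| ≤ B := by
    obtain ⟨B, hB⟩ := (isCompact_Icc : IsCompact (Icc (0 : ℝ) M)).exists_bound_of_continuousOn
      hΦec.continuousOn
    exact ⟨B, fun t ht ↦ by simpa only [Real.norm_eq_abs] using hB t ht⟩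
  have hBe0 : 0 ≤ Be := (abs_nonneg _).trans (hBe 0 ⟨le_rfl, hM0.le⟩)
  have hB2 : ∀ t ∈ Icc (0 : ℝ) M, |t ^ 2| ≤ M ^ 2 := fun t ht ↦ by
    rw [abs_of_nonneg (sq_nonneg _)]
    exact pow_le_pow_left₀ ht.1 ht.2 2
  set Bmax : ℝ := max (M ^ 2) Be with hBmax
  have hBmax0 : 0 ≤ Bmax := le_max_of_le_left (sq_nonneg _)
  -- the inner radius `r₁`
  set r₁ : ℝ := min (ρ₀ / 2) (min 1 (ε / (8 * ω * (Bmax + 1) + 1))) with hr₁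
  have hr₁pos : 0 < r₁ := by positivity
  have hr₁ρ : r₁ < ρ₀ := (min_le_left _ _).trans_lt (by linarith)
  have hr₁1 : r₁ ≤ 1 := (min_le_right _ _).trans (min_le_left _ _)
  have hinner : ∀ B : ℝ, 0 ≤ B → B ≤ Bmax →
      2 * B * (volume (ball (0 : EuclideanSpace ℝ (Fin 4)) r₁)).toReal ≤ ε / 4 := by
    intro B hB hBB
    rw [hvball r₁ hr₁pos.le]
    have h4 : r₁ ^ 4 ≤ r₁ := by
      calc r₁ ^ 4 ≤ r₁ ^ 1 := pow_le_pow_of_le_one hr₁pos.le hr₁1 (by norm_num)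
        _ = r₁ := pow_one _
    have h5 : r₁ ≤ ε / (8 * ω * (Bmax + 1) + 1) := (min_le_right _ _).trans (min_le_right _ _)
    calc 2 * B * (ω * r₁ ^ 4) ≤ 2 * Bmax * (ω * r₁) := by gcongr
      _ ≤ 2 * Bmax * (ω * (ε / (8 * ω * (Bmax + 1) + 1))) := by gcongr
      _ ≤ ε / 4 := by
          rw [mul_div_assoc', mul_div_assoc', div_le_iff₀ (by positivity)]
          nlinarith [mul_nonneg hBmax0 hωpos.le, hε]
  -- shell accuracy `ηe` and the increment bound `δ`
  set Vρ : ℝ := (volume (closedBall (0 : EuclideanSpace ℝ (Fin 4)) ρ₀)).toReal with hVρ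
  have hVρ0 : 0 ≤ Vρ := ENNReal.toReal_nonneg
  set ηe : ℝ := ε / (4 * (Vρ + 1)) with hηe
  have hηe0 : 0 < ηe := by positivity
  have hηeV : ηe * Vρ ≤ ε / 4 := by
    rw [hηe, div_mul_eq_mul_div, div_le_iff₀ (by positivity)]
    nlinarith [hε]
  -- uniform continuity of `Φe` on `[0, M]`
  obtain ⟨δe, hδe0, hδe⟩ : ∃ δe > 0, ∀ t ∈ Icc (0 : ℝ) M, ∀ t' ∈ Icc (0 : ℝ) M,
      |t - t'| < δe → |Φe t - Φe t'| < ηe := by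
    have huc := (isCompact_Icc : IsCompact (Icc (0 : ℝ) M)).uniformContinuousOn_of_continuous
      hΦec.continuousOn
    rw [Metric.uniformContinuousOn_iff] at huc
    obtain ⟨δ, hδ, h⟩ := huc ηe hηe0
    exact ⟨δ, hδ, fun t ht t' ht' htt' ↦ by
      have := h t ht t' ht' (by rwa [Real.dist_eq])
      rwa [Real.dist_eq] at this⟩
  set δ : ℝ := min (ηe / (2 * M + 1)) (δe / 2) with hδ
  have hδ0 : 0 < δ := by positivity
  have hδe' : δ < δe := (min_le_right _ _).trans_lt (by linarith)
  have hδ2M : 2 * M * δ ≤ ηe := by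
    have : δ ≤ ηe / (2 * M + 1) := min_le_left _ _
    calc 2 * M * δ ≤ 2 * M * (ηe / (2 * M + 1)) := by gcongr
      _ ≤ ηe := by
          rw [mul_div_assoc', div_le_iff₀ (by positivity)]
          nlinarith [hηe0, hM0]
  -- uniform continuity of the profile `f` on `[r₁, ρ₀]`
  obtain ⟨δf, hδf0, hδf⟩ : ∃ δf > 0, ∀ r ∈ Icc r₁ ρ₀, ∀ r' ∈ Icc r₁ ρ₀,
      |r - r'| < δf → |f r - f r'| < δ := by
    have huc := (isCompact_Icc : IsCompact (Icc r₁ ρ₀)).uniformContinuousOn_of_continuous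
      hfc.continuousOn
    rw [Metric.uniformContinuousOn_iff] at huc
    obtain ⟨δ', hδ', h⟩ := huc δ hδ0
    exact ⟨δ', hδ', fun r hr r' hr' hrr' ↦ by
      have := h r hr r' hr' (by rwa [Real.dist_eq])
      rwa [Real.dist_eq] at this⟩
  -- the mesh: `N` steps of size `Δ < min δf (s r₁)`
  set m₀ : ℝ := min δf (s * r₁) with hm₀
  have hm₀0 : 0 < m₀ := by positivity
  obtain ⟨N, hNreal⟩ := exists_nat_gt ((ρ₀ - r₁) / m₀)
  have hNpos : 0 < N := by
    have : (0 : ℝ) < N := lt_trans (div_pos (by linarith) hm₀0) hNreal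
    exact_mod_cast this
  have hNne : (N : ℝ) ≠ 0 := by exact_mod_cast hNpos.ne'
  set Δ : ℝ := (ρ₀ - r₁) / N with hΔ
  have hΔpos : 0 < Δ := div_pos (by linarith) (by exact_mod_cast hNpos)
  have hΔm : Δ < m₀ := by
    rw [hΔ, div_lt_iff₀ (by exact_mod_cast hNpos)]
    rw [div_lt_iff₀ hm₀0] at hNreal
    linarith
  have hΔf : Δ < δf := hΔm.trans_le (min_le_left _ _)
  have hΔs : Δ ≤ s * r₁ := hΔm.le.trans (min_le_right _ _)
  set R : ℕ → ℝ := fun j ↦ ρ₀ - j * Δ with hR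
  have hRanti : StrictAnti R := fun j k hjk ↦ by
    simp only [hR]
    have : (j : ℝ) < k := by exact_mod_cast hjk
    nlinarith
  have hR0 : R 0 = ρ₀ := by simp [hR]
  have hRN : R N = r₁ := by
    simp only [hR, hΔ]
    rw [mul_div_cancel₀ _ hNne]
    ring
  have hRNpos : 0 < R N := by rw [hRN]; exact hr₁pos
  have hRsucc : ∀ j, R j = R (j + 1) + Δ := fun j ↦ by simp only [hR]; push_cast; ring
  have hRmem : ∀ j ≤ N, R j ∈ Icc r₁ ρ₀ := fun j hj ↦
    ⟨hRN ▸ hRanti.antitone hj, hR0 ▸ hRanti.antitone (Nat.zero_le j)⟩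
  have hRpos : ∀ j ≤ N, 0 < R j := fun j hj ↦ hr₁pos.trans_le (hRmem j hj).1
  -- levels and increments
  set τ : ℕ → ℝ := fun j ↦ f (R j) with hτ
  have hτ0 : τ 0 = 0 := by simp only [hτ, hR0]; exact hf0
  have hτmono : ∀ j, j + 1 ≤ N → τ j ≤ τ (j + 1) := fun j hj ↦
    hfanti (hRpos _ hj).le (hRanti (Nat.lt_succ_self j)).le
  have hτincr : ∀ j, j + 1 ≤ N → τ (j + 1) - τ j < δ := by
    intro j hj
    have h := hδf (R (j + 1)) (hRmem _ hj) (R j) (hRmem _ ((Nat.le_succ j).trans hj)) (by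
      rw [hRsucc j, abs_sub_comm, add_sub_cancel_left, abs_of_pos hΔpos]; exact hΔf)
    simp only [hτ]
    exact (le_abs_self _).trans_lt h
  have hτnn : ∀ j, 0 ≤ τ j := fun j ↦ hfnn _
  have hτM : ∀ j, τ j ≤ M := fun j ↦ hfM _
  set cc : ℕ → ℝ := fun j ↦ max 0 (τ (j + 1) - τ j) with hcc
  have hcc0 : ∀ j, 0 ≤ cc j := fun j ↦ le_max_left _ _
  have hcc_eq : ∀ j, j + 1 ≤ N → cc j = τ (j + 1) - τ j := fun j hj ↦
    max_eq_right (sub_nonneg.2 (hτmono j hj))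
  have hsumτ : ∀ i ≤ N, ∑ j ∈ Finset.range i, cc j = τ i := by
    intro i hi
    induction i with
    | zero => simp [hτ0]
    | succ i ih =>
      rw [Finset.sum_range_succ, ih ((Nat.le_succ i).trans hi), hcc_eq i hi]
      ring
  ------------------------------------------------------------------
  -- Step 2: the staircase `v` and its qualitative properties
  ------------------------------------------------------------------
  set v : EuclideanSpace ℝ (Fin 4) → ℝ := stairFun N R cc with hv
  obtain ⟨K, hK⟩ := stairFun_lipschitz (c := cc) hRanti hRNpos
  have hvs : HasCompactSupport v := hasCompactSupport_stairFun hRanti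
  have hvm : Measurable v := hK.continuous.measurable
  have hv0 : ∀ x, 0 ≤ v x := fun x ↦ stairFun_nonneg hRanti hRNpos hcc0 x
  have hvM : ∀ x, v x ≤ M := fun x ↦
    (stairFun_le_sum hRanti hRNpos hcc0 x).trans (by rw [hsumτ N le_rfl]; exact hτM N)
  have hvzero : ∀ x : EuclideanSpace ℝ (Fin 4), ρ₀ ≤ ‖x‖ → v x = 0 := fun x hx ↦
    stairFun_eq_zero hRanti (by rwa [hR0])
  -- `|v - U| ≤ δ` off the inner ball
  have hclose : ∀ x : EuclideanSpace ℝ (Fin 4), r₁ ≤ ‖x‖ → |v x - U x| ≤ δ := by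
    intro x hx
    by_cases hxρ : ‖x‖ ≤ ρ₀
    · obtain ⟨i, hi, hi1, hi2⟩ := exists_index_of_mem_shell (R := R) (r := ‖x‖) hNpos
        (by rw [hRN]; exact hx) (by rw [hR0]; exact hxρ)
      have hiN : i + 1 ≤ N := Nat.succ_le_of_lt hi
      have hvx := stairFun_mem_Icc hRanti hRNpos hcc0 hi ⟨hi1, hi2⟩
      rw [hsumτ i hi.le, hsumτ (i + 1) hiN] at hvx
      have hUx1 : τ i ≤ U x := by
        have := hUanti (x := x) (y := R i • e) (by rw [hnorm _ (hRpos i hi.le).le]; exact hi2)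
        simpa [hτ, hf] using this
      have hUx2 : U x ≤ τ (i + 1) := by
        have := hUanti (x := R (i + 1) • e) (y := x) (by rw [hnorm _ (hRpos _ hiN).le]; exact hi1)
        simpa [hτ, hf] using this
      have hvx' : v x ∈ Icc (τ i) (τ (i + 1)) := hvx
      rw [abs_le]
      constructor <;> nlinarith [hvx'.1, hvx'.2, hτincr i hiN]
    · rw [not_le] at hxρ
      rw [hvzero x hxρ.le, hUzero x hxρ.le, sub_self, abs_zero]
      exact hδ0.le
  ------------------------------------------------------------------
  -- Step 3: norm and entropy
  ------------------------------------------------------------------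
  have hUmem : ∀ x, U x ∈ Icc 0 M := fun x ↦ ⟨hU0 x, hUM x⟩
  have hvmem : ∀ x, v x ∈ Icc 0 M := fun x ↦ ⟨hv0 x, hvM x⟩
  have hVρeq : (volume (closedBall (0 : EuclideanSpace ℝ (Fin 4)) ρ₀)).toReal = Vρ := rfl
  -- `L²` norms
  have hsq : |(∫ x, v x ^ 2) - ∫ x, U x ^ 2| ≤ ε / 2 := by
    have h := abs_integral_comp_sub_le (Φ := fun t ↦ t ^ 2) (M := M) (B := M ^ 2) (δ := δ)
      (η := ηe) (r₁ := r₁) (r₀ := ρ₀) hvm hUm (continuous_pow 2) (by simp) hvmem hUmem hB2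
      (fun t ht t' ht' htt' ↦ by
        have : |t ^ 2 - t' ^ 2| = |t - t'| * |t + t'| := by
          rw [← abs_mul]; congr 1; ring
        rw [this]
        have ht2 : |t + t'| ≤ 2 * M := by
          rw [abs_of_nonneg (by linarith [ht.1, ht'.1])]; linarith [ht.2, ht'.2]
        calc |t - t'| * |t + t'| ≤ δ * (2 * M) :=
              mul_le_mul htt' ht2 (abs_nonneg _) hδ0.le
          _ ≤ ηe := by linarith [hδ2M])
      hηe0.le hclose (fun x hx ↦ hvzero x hx.le) (fun x hx ↦ hUzero x hx.le)
    refine h.trans ?_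
    have h1 := hinner (M ^ 2) (sq_nonneg _) (le_max_left _ _)
    rw [hVρeq] at *
    linarith [hηeV]
  have hent : |(∫ x, Φe (v x)) - ∫ x, Φe (U x)| ≤ ε / 2 := by
    have h := abs_integral_comp_sub_le (Φ := Φe) (M := M) (B := Be) (δ := δ)
      (η := ηe) (r₁ := r₁) (r₀ := ρ₀) hvm hUm hΦec (by simp [hΦe]) hvmem hUmem hBe
      (fun t ht t' ht' htt' ↦ (hδe t ht t' ht' (htt'.trans_lt hδe')).le)
      hηe0.le hclose (fun x hx ↦ hvzero x hx.le) (fun x hx ↦ hUzero x hx.le)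
    refine h.trans ?_
    have h1 := hinner Be hBe0 (le_max_right _ _)
    rw [hVρeq] at *
    linarith [hηeV]
  -- equimeasurability: the norms and entropies of `U` are those of `w`
  have hU2 : ∫ x, U x ^ 2 = ∫ a, w a ^ 2 ∂μ := integral_symmDecRearr_sq four_ne hw hw0 hM' hfin
  have hUe : ∫ x, Φe (U x) = ∫ a, Φe (w a) ∂μ :=
    integral_symmDecRearr_sq_mul_log four_ne hw hw0 hM' hfin
  ------------------------------------------------------------------
  -- Step 4: the energy
  ------------------------------------------------------------------
  -- the slabs
  set S : ℕ → Set X := fun j ↦ {a | τ j < w a ∧ w a < τ (j + 1)} with hS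
  have hSm : ∀ j, MeasurableSet (S j) := fun j ↦
    (measurableSet_lt measurable_const hw).inter (measurableSet_lt hw measurable_const)
  have hSfin : ∀ j, μ (S j) ≠ ∞ := fun j ↦
    ne_top_of_le_ne_top (hfin' (hτnn j)) (measure_mono fun a ha ↦ ha.1)
  -- the per-slab bound
  have hslab_bound : ∀ j, j + 1 ≤ N →
      4 * Real.pi ^ 2 * cc j ^ 2 / annulusCapD (R (j + 1)) (R j) ≤
        Kc * (2 + 10 * s) * ∫ a in S j, ρ a ^ 2 ∂μ := by
    intro j hj
    set a := R (j + 1) with ha_def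
    set b := R j with hb_def
    have ha : 0 < a := hRpos _ hj
    have hab : a < b := hRanti (Nat.lt_succ_self j)
    have hb : 0 < b := ha.trans hab
    have hEj : 0 ≤ ∫ a in S j, ρ a ^ 2 ∂μ := integral_nonneg fun a ↦ sq_nonneg _
    -- the mesh ratio
    have hq1 : 1 ≤ b / a := by rw [le_div_iff₀ ha]; linarith
    have hq2 : b / a ≤ 1 + s := by
      rw [div_le_iff₀ ha]
      have : b = a + Δ := hRsucc j
      have hra : r₁ ≤ a := (hRmem _ hj).1
      nlinarith
    have hQ : b ^ 2 * (b ^ 2 + a ^ 2) / a ^ 4 ≤ 2 + 10 * s := by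
      have : b ^ 2 * (b ^ 2 + a ^ 2) / a ^ 4 = (b / a) ^ 2 * ((b / a) ^ 2 + 1) := by
        field_simp
      rw [this]
      exact ratio_factor_le hq1 hq2 hs0.le hs4
    by_cases hd : cc j = 0
    · rw [hd]
      simp only [ne_eq, OfNat.ofNat_ne_zero, not_false_eq_true, zero_pow, mul_zero, zero_div]
      positivity
    -- a genuine slab: `τ j < τ (j+1)`
    have hdpos : 0 < cc j := lt_of_le_of_ne (hcc0 j) (Ne.symm hd)
    have hτlt : τ j < τ (j + 1) := by rw [hcc_eq j hj] at hdpos; linarith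
    have hτ'pos : 0 < τ (j + 1) := (hτnn j).trans_lt hτlt
    -- sphere points
    have hxa : ‖a • e‖ = a := hnorm a ha.le
    have hxb : ‖b • e‖ = b := hnorm b hb.le
    have hUa : U (a • e) = τ (j + 1) := rfl
    have hUb : U (b • e) = τ j := rfl
    -- (iii) the volume of the slab: `μ S_j ≤ |B(0,b)| - |B̄(0,a)|`
    have hcb_sub : closedBall (0 : EuclideanSpace ℝ (Fin 4)) a ⊆ {x | τ (j + 1) ≤ U x} := by
      intro y hy
      rw [mem_closedBall, dist_zero_right] at hy
      have := hUanti (x := y) (y := a • e) (by rw [hxa]; exact hy)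
      rw [hUa] at this
      exact this
    have hball_sup : {x | τ j < U x} ⊆ ball (0 : EuclideanSpace ℝ (Fin 4)) b := by
      intro y hy
      rw [mem_ball, dist_zero_right]
      by_contra hge
      rw [not_lt] at hge
      have := hUanti (x := b • e) (y := y) (by rw [hxb]; exact hge)
      rw [hUb] at this
      exact absurd (lt_of_lt_of_le hy this) (lt_irrefl _)
    have hvol1 : volume (closedBall (0 : EuclideanSpace ℝ (Fin 4)) a) ≤ μ {a' | τ (j + 1) ≤ w a'} := by
      rw [← volume_le_symmDecRearr four_ne hw hM' hfin hτ'pos]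
      exact measure_mono hcb_sub
    have hvol2 : μ {a' | τ j < w a'} ≤ volume (ball (0 : EuclideanSpace ℝ (Fin 4)) b) := by
      rw [← volume_lt_symmDecRearr four_ne hM' (hτnn j) (hfin' (hτnn j))]
      exact measure_mono hball_sup
    have hadd : μ (S j) + volume (closedBall (0 : EuclideanSpace ℝ (Fin 4)) a) ≤
        volume (ball (0 : EuclideanSpace ℝ (Fin 4)) b) := by
      calc μ (S j) + volume (closedBall (0 : EuclideanSpace ℝ (Fin 4)) a)
          ≤ μ (S j) + μ {a' | τ (j + 1) ≤ w a'} := add_le_add le_rfl hvol1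
        _ = μ (S j ∪ {a' | τ (j + 1) ≤ w a'}) := by
            rw [measure_union _ (measurableSet_le measurable_const hw)]
            exact disjoint_left.2 fun a' ha' (ha'' : τ (j + 1) ≤ w a') ↦
              absurd (lt_of_lt_of_le ha'.2 ha'') (lt_irrefl _)
        _ ≤ μ {a' | τ j < w a'} := measure_mono (union_subset (fun a' ha' ↦ ha'.1)
            (fun a' (ha' : τ (j + 1) ≤ w a') ↦ lt_of_lt_of_le hτlt ha'))
        _ ≤ volume (ball (0 : EuclideanSpace ℝ (Fin 4)) b) := hvol2
    have hA : (μ (S j)).toReal ≤ ω * (b ^ 4 - a ^ 4) := by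
      have h1 : μ (S j) ≤ volume (ball (0 : EuclideanSpace ℝ (Fin 4)) b) -
          volume (closedBall (0 : EuclideanSpace ℝ (Fin 4)) a) :=
        ENNReal.le_sub_of_add_le_right (hvcballT a) hadd
      have h2 := ENNReal.toReal_mono (ENNReal.sub_ne_top (hvballT b)) h1
      rw [ENNReal.toReal_sub_of_le ((le_add_left le_rfl).trans hadd) (hvballT b), hvball b hb.le,
        hvcball a ha.le] at h2
      linarith
    -- (i) the level bound: `c (ω a⁴)^{3/4} (τ(j+1) - τ j) ≤ c μ{w ≥ τ(j+1)}^{3/4} (τ(j+1) - τ j) ≤ ∫_{S_j} ρ`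
    set L : ℝ := ∫ a' in S j, ρ a' ∂μ with hL
    have hL0 : 0 ≤ L := integral_nonneg hρ0
    have hfin2 : μ {a' | τ (j + 1) ≤ w a'} ≠ ∞ :=
      ne_top_of_le_ne_top hfin (measure_mono fun a' (ha' : τ (j + 1) ≤ w a') ↦
        lt_of_lt_of_le hτ'pos ha')
    have hlow : ω * a ^ 4 ≤ (μ {a' | τ (j + 1) ≤ w a'}).toReal := by
      rw [← hvcball a ha.le]
      exact ENNReal.toReal_mono hfin2 hvol1
    have h_i : c * (ω * a ^ 4) ^ (3 / 4 : ℝ) * (τ (j + 1) - τ j) ≤ L := by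
      have h1 := hlevel (τ j) (τ (j + 1)) (hτnn j) hτlt
      have hmono : c * (ω * a ^ 4) ^ (3 / 4 : ℝ) * (τ (j + 1) - τ j) ≤
          c * (μ {a' | τ (j + 1) ≤ w a'}).toReal ^ (3 / 4 : ℝ) * (τ (j + 1) - τ j) :=
        mul_le_mul_of_nonneg_right (mul_le_mul_of_nonneg_left
          (Real.rpow_le_rpow (by positivity) hlow (by norm_num)) hc.le) (sub_nonneg.2 hτlt.le)
      exact hmono.trans h1
    -- (ii) Cauchy–Schwarz
    have h_ii : L ^ 2 ≤ (μ (S j)).toReal * ∫ a' in S j, ρ a' ^ 2 ∂μ :=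
      sq_setIntegral_le_measure_mul (hSfin j) hρ0 hρm.aestronglyMeasurable hρ2.integrableOn
    -- (iv) the algebra
    have halg := slab_energy_algebra hc hωpos ha hab (sub_nonneg.2 (hτmono j hj)) h_i h_ii hEj hA
    rw [hcc_eq j hj]
    refine halg.trans ?_
    rw [← hKc]
    have hlast : Kc * (b ^ 2 * (b ^ 2 + a ^ 2) / a ^ 4) * (∫ a' in S j, ρ a' ^ 2 ∂μ) ≤
        Kc * (2 + 10 * s) * (∫ a' in S j, ρ a' ^ 2 ∂μ) := by gcongr
    exact hlast
  -- summing over the disjoint slabs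
  have hdisj : Set.Pairwise (↑(Finset.range N)) (Function.onFun Disjoint S) := by
    intro j hj k hk hjk
    rcases lt_or_gt_of_ne hjk with h | h
    · refine disjoint_left.2 fun a ha ha' ↦ ?_
      have h1 : τ (j + 1) ≤ τ k := by
        have hkN : k ≤ N := (Finset.mem_range.1 hk).le
        -- monotonicity of `τ` between `j+1` and `k`
        have hmono : ∀ p q, p ≤ q → q ≤ N → τ p ≤ τ q := by
          intro p q hpq hqN
          induction hpq with
          | refl => exact le_rfl
          | step hle ih => exact (ih ((Nat.le_succ _).trans hqN)).trans (hτmono _ hqN)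
        exact hmono _ _ (Nat.succ_le_of_lt h) hkN
      exact absurd (lt_of_lt_of_le (ha.2.trans_le h1) ha'.1.le) (lt_irrefl _)
    · refine disjoint_left.2 fun a ha ha' ↦ ?_
      have h1 : τ (k + 1) ≤ τ j := by
        have hjN : j ≤ N := (Finset.mem_range.1 hj).le
        have hmono : ∀ p q, p ≤ q → q ≤ N → τ p ≤ τ q := by
          intro p q hpq hqN
          induction hpq with
          | refl => exact le_rfl
          | step hle ih => exact (ih ((Nat.le_succ _).trans hqN)).trans (hτmono _ hqN)
        exact hmono _ _ (Nat.succ_le_of_lt h) hjN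
      exact absurd (lt_of_lt_of_le (ha'.2.trans_le h1) ha.1.le) (lt_irrefl _)
  have hsumE : ∑ j ∈ Finset.range N, ∫ a in S j, ρ a ^ 2 ∂μ ≤ G := by
    rw [← integral_biUnion_finset _ (fun j _ ↦ hSm j) hdisj (fun j _ ↦ hρ2.integrableOn)]
    exact setIntegral_le_integral hρ2 (ae_of_all _ fun a ↦ sq_nonneg _)
  have henergy : ∫ x, ‖fderiv ℝ v x‖ ^ 2 ≤ (8 * Real.sqrt 2 * Real.pi / c ^ 2) * G + ε := by
    rw [hv, integral_norm_fderiv_stairFun_sq hRanti hRNpos]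
    calc ∑ j ∈ Finset.range N, 4 * Real.pi ^ 2 * cc j ^ 2 / annulusCapD (R (j + 1)) (R j)
        ≤ ∑ j ∈ Finset.range N, Kc * (2 + 10 * s) * ∫ a in S j, ρ a ^ 2 ∂μ :=
          Finset.sum_le_sum fun j hj ↦ hslab_bound j (Finset.mem_range.1 hj)
      _ = Kc * (2 + 10 * s) * ∑ j ∈ Finset.range N, ∫ a in S j, ρ a ^ 2 ∂μ := by
          rw [Finset.mul_sum]
      _ ≤ Kc * (2 + 10 * s) * G := by gcongr
      _ = 2 * Kc * G + 10 * Kc * s * G := by ring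
      _ ≤ (8 * Real.sqrt 2 * Real.pi / c ^ 2) * G + ε / 2 := by rw [hKc2]; linarith [hsG]
      _ ≤ (8 * Real.sqrt 2 * Real.pi / c ^ 2) * G + ε := by linarith
  ------------------------------------------------------------------
  -- conclusion
  ------------------------------------------------------------------
  refine ⟨v, K, hK, hvs, ?_, ?_, henergy⟩
  · rw [← hU2]
    linarith [hsq, abs_le.1 hsq]
  · rw [show (fun a ↦ w a ^ 2 * Real.log (w a ^ 2)) = fun a ↦ Φe (w a) from rfl, ← hUe]
    have := (abs_le.1 hent).1
    change (∫ x, Φe (U x)) ≤ (∫ x, Φe (v x)) + ε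
    linarith

/-- **Discretised Pólya–Szegő inequality in dimension four.** Let `w ≥ 0` be a bounded measurable
function on a measure space with `0 < μ{w > 0} < ∞`, whose distribution function `t ↦ μ{w > t}` is
strictly decreasing on `[0, M]` (`w ≤ M`), and let `ρ ≥ 0` be integrable and square-integrable.
Suppose the **slab inequality** `∫_{t₁}^{t₂} c μ{w > t}^{3/4} dt ≤ ∫_{t₁ < w < t₂} ρ dμ` holds for all
`0 ≤ t₁ < t₂` (coarea + isoperimetry with profile `c v^{3/4}`). Then for every `ε > 0` there is a
compactly supported Lipschitz `v : ℝ⁴ → ℝ` with `|∫ v² dx − ∫ w² dμ| ≤ ε`,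
`∫ w² log w² dμ ≤ ∫ v² log v² dx + ε` and `∫ ‖Dv‖² dx ≤ (8√2π/c²) ∫ ρ² dμ + ε` — a staircase of
capacitor potentials through the values of `u♯ = symmDecRearr 4 μ w` on a fine mesh of radii (see
the module docstring). For `c = 4 ω₄^{1/4} θ^{1/4}` the constant is `θ^{-1/2}`, that of the
Pólya–Szegő inequality (2.4) of Balogh–Kristály–Tripaldi 2024 / Nobili–Violo 2024, Prop. 3.3.
(The slab inequality implies the level bound of
`exists_lipschitz_discretePolyaSzego_four_of_levelBound`, since `μ{w > t} ≥ μ{w ≥ t₂}` for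
`t < t₂`.)
[cite: BaloghKristalyTripaldi2024, §2.1 (2.4) and §3.1] [cite: NobiliViolo2024, §3.1 Prop. 3.3] -/
theorem exists_lipschitz_discretePolyaSzego_four
    {X : Type*} [MeasurableSpace X] {μ : Measure X} {w ρ : X → ℝ}
    (hw : Measurable w) (hw0 : ∀ a, 0 ≤ w a) {M : ℝ} (hM0 : 0 < M) (hwM : ∀ a, w a ≤ M)
    (hfin : μ {a | 0 < w a} ≠ ∞) (hpos : μ {a | 0 < w a} ≠ 0)
    (hstrict : StrictAntiOn (fun t ↦ μ {a | t < w a}) (Icc 0 M))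
    (hρm : Measurable ρ) (hρ0 : ∀ a, 0 ≤ ρ a) (hρi : Integrable ρ μ)
    (hρ2 : Integrable (fun a ↦ ρ a ^ 2) μ) {c : ℝ} (hc : 0 < c)
    (hslab : ∀ t₁ t₂ : ℝ, 0 ≤ t₁ → t₁ < t₂ →
      ∫⁻ t in Ioo t₁ t₂, ENNReal.ofReal (c * (μ {a | t < w a}).toReal ^ (3 / 4 : ℝ)) ≤
        ∫⁻ a in {a | t₁ < w a ∧ w a < t₂}, ENNReal.ofReal (ρ a) ∂μ)
    {ε : ℝ} (hε : 0 < ε) :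
    ∃ (v : EuclideanSpace ℝ (Fin 4) → ℝ) (K : ℝ≥0), LipschitzWith K v ∧ HasCompactSupport v ∧
      |(∫ x, v x ^ 2) - (∫ a, w a ^ 2 ∂μ)| ≤ ε ∧
      (∫ a, w a ^ 2 * Real.log (w a ^ 2) ∂μ) ≤ (∫ x, v x ^ 2 * Real.log (v x ^ 2)) + ε ∧
      (∫ x, ‖fderiv ℝ v x‖ ^ 2) ≤ (8 * Real.sqrt 2 * Real.pi / c ^ 2) * (∫ a, ρ a ^ 2 ∂μ) + ε := by
  refine exists_lipschitz_discretePolyaSzego_four_of_levelBound hw hw0 hM0 hwM hfin hpos hstrict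
    hρm hρ0 hρ2 hc (fun t₁ t₂ ht₁ h12 ↦ ?_) hε
  -- finiteness of the superlevel sets of non-negative level
  have hfin' : ∀ {t : ℝ}, 0 ≤ t → μ {a | t < w a} ≠ ∞ := fun ht ↦
    ne_top_of_le_ne_top hfin (measure_mono fun a (ha : _ < w a) ↦ lt_of_le_of_lt ht ha)
  set m : ℝ := (μ {a | t₂ ≤ w a}).toReal with hm
  set L : ℝ := ∫ a in {a | t₁ < w a ∧ w a < t₂}, ρ a ∂μ with hL
  have hL0 : 0 ≤ L := integral_nonneg hρ0
  -- the integrand dominates the constant `c m^{3/4}` on `(t₁, t₂)`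
  have hlow : ∀ t ∈ Ioo t₁ t₂, m ≤ (μ {a | t < w a}).toReal := by
    intro t ht
    have ht0 : 0 ≤ t := ht₁.trans ht.1.le
    exact ENNReal.toReal_mono (hfin' ht0) (measure_mono fun a (ha : t₂ ≤ w a) ↦
      lt_of_lt_of_le ht.2 ha)
  have hconst : ∫⁻ t in Ioo t₁ t₂, ENNReal.ofReal (c * m ^ (3 / 4 : ℝ)) ≤
      ∫⁻ t in Ioo t₁ t₂, ENNReal.ofReal (c * (μ {a | t < w a}).toReal ^ (3 / 4 : ℝ)) :=
    setLIntegral_mono' measurableSet_Ioo fun t ht ↦ ENNReal.ofReal_le_ofReal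
      (mul_le_mul_of_nonneg_left (Real.rpow_le_rpow ENNReal.toReal_nonneg (hlow t ht)
        (by norm_num)) hc.le)
  rw [setLIntegral_const, Real.volume_Ioo, ← ENNReal.ofReal_mul (by positivity)] at hconst
  have hrhs : ∫⁻ a in {a | t₁ < w a ∧ w a < t₂}, ENNReal.ofReal (ρ a) ∂μ = ENNReal.ofReal L := by
    rw [hL, ofReal_integral_eq_lintegral_ofReal hρi.integrableOn (ae_of_all _ hρ0)]
  have h2 := (hconst.trans (hslab t₁ t₂ ht₁ h12)).trans_eq hrhs
  exact (ENNReal.ofReal_le_ofReal_iff hL0).1 h2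

end Literature.Analysis.FunctionSpaces

end
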